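import Summits.Ventures.LatticeQCDFlow.Scoring.UNHaarEntryFourthMoments
import HarnessLib

/-!
# The fourth trace moment of a Haar unitary: `∫_{U(N)} |tr U|⁴ dU = 2` for every `N ≥ 2`

HONEST FRAMING: exact (Metropolis-corrected) sampling algorithms for lattice gauge theory;
figures of merit are autocorrelation/cost numbers at stated couplings and volumes; no
continuum-physics claim.

Venture `LatticeQCDFlow` (cell pub-lqcd), sub-topic `Scoring`; FANOUT row 5 (`s0-sun-a`), GEN-20.
NEW WORK of the cell (placement rule).  Sequel of `UNHaarEntryFourthMoments` (`∫ |U_ii|⁴ = 2/(N(N+1))`,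
`∫ |U_ii|²|U_jj|² = 1/(N²−1)`) and of `TrivializingMaps.UNHaarTraceMoments` (`∫ |tr U|² = 1`).  Expanding
`|tr U|⁴ = Σ_{ijkl} U_ii U_jj Ū_kk Ū_ll`:

* §1 **diagonal circles kill the unpaired terms**: `∫ U_ii U_jj Ū_kk Ū_ll dU = 0` unless `(k,l) ∈ {(i,j),(j,i)}` (left
  multiplication by `diag(pairFun m m′ w)` with `w = e^{iπ/4}` multiplies the integrand by `w`, `w²`, `w³` or `w⁴ ≠ 1`);
* §2 **`∫_{U(N)} |tr U|⁴ dU = N·2/(N(N+1)) + 2N(N−1)/(N²−1) = 2`** (`un_integral_normSq_trace_sq`), hence the Haar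
  VARIANCE of the plaquette observable `|tr U_p|²` at `β = 0` is `2 − 1 = 1` (`un_integral_normSq_trace_sub_one_sq`).

Classically `∫_{U(N)} |tr U|^{2n} = n!` for `n ≤ N` (Diaconis–Shahshahani); this is the case `n = 2` by elementary
invariance, for every `N ≥ 2` (for `N = 1` the value is `1`).  No `def`, nothing cited as a fact, 0 sorry.
-/

noncomputable section

open Real MeasureTheory Filter Topology Finset Complex
open Literature.MathematicalPhysics.QuantumFieldTheory
open Literature.MathematicalPhysics.QuantumLattice
open Summit.Ventures.LatticeQCDFlow.TrivializingMaps

namespace Summit.Ventures.LatticeQCDFlow.Scoring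

variable {N : ℕ}

/-! ## §1 Diagonal circles kill the unpaired degree-4 diagonal moments -/

/-- Values of `pairFun m m′ w`: `(if n = m then w else 1)·(if n = m′ then w⁻¹ else 1)`. -/
theorem pairFun_apply_ite (m m' n : Fin N) (w : ℂ) :
    pairFun m m' w n = (if n = m then w else 1) * (if n = m' then w⁻¹ else 1) := by
  simp [pairFun, Pi.mulSingle_apply]

/-- **Left diagonal circles rescale the degree-4 diagonal moments**: with `φ = pairFun m m′ w`,
`∫ U_ii U_jj Ū_kk Ū_ll = φ_i φ_j φ̄_k φ̄_l · ∫ U_ii U_jj Ū_kk Ū_ll`. -/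
theorem un_integral_diag4_eq_mul (i j k l m m' : Fin N) (w : Circle) :
    ∫ U, (U : Matrix (Fin N) (Fin N) ℂ) i i * (U : Matrix (Fin N) (Fin N) ℂ) j j * (starRingEnd ℂ) ((U : Matrix (Fin N) (Fin N) ℂ) k k) * (starRingEnd ℂ) ((U : Matrix (Fin N) (Fin N) ℂ) l l) ∂(haarProbability (Matrix.unitaryGroup (Fin N) ℂ))
      = (pairFun m m' (w : ℂ) i * pairFun m m' (w : ℂ) j * (starRingEnd ℂ) (pairFun m m' (w : ℂ) k)
          * (starRingEnd ℂ) (pairFun m m' (w : ℂ) l))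
        * ∫ U, (U : Matrix (Fin N) (Fin N) ℂ) i i * (U : Matrix (Fin N) (Fin N) ℂ) j j * (starRingEnd ℂ) ((U : Matrix (Fin N) (Fin N) ℂ) k k) * (starRingEnd ℂ) ((U : Matrix (Fin N) (Fin N) ℂ) l l) ∂(haarProbability (Matrix.unitaryGroup (Fin N) ℂ)) := by
  set D : Matrix.unitaryGroup (Fin N) ℂ := ⟨Matrix.diagonal (pairFun m m' (w : ℂ)), diagonal_pairFun_mem_unitaryGroup m m' w⟩
    with hD
  have key := integral_mul_left_eq_self (μ := (haarProbability (Matrix.unitaryGroup (Fin N) ℂ)))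
    (fun U : Matrix.unitaryGroup (Fin N) ℂ => (U : Matrix (Fin N) (Fin N) ℂ) i i * (U : Matrix (Fin N) (Fin N) ℂ) j j * (starRingEnd ℂ) ((U : Matrix (Fin N) (Fin N) ℂ) k k) * (starRingEnd ℂ) ((U : Matrix (Fin N) (Fin N) ℂ) l l)) D
  have hent : ∀ (U : Matrix.unitaryGroup (Fin N) ℂ) (n : Fin N),
      ((D * U : Matrix.unitaryGroup (Fin N) ℂ) : Matrix (Fin N) (Fin N) ℂ) n n = pairFun m m' (w : ℂ) n * (U : Matrix (Fin N) (Fin N) ℂ) n n :=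
    fun U n => by
      show (Matrix.diagonal (pairFun m m' (w : ℂ)) * (U : Matrix (Fin N) (Fin N) ℂ)) n n = _
      rw [Matrix.diagonal_mul]
  simp only [hent, map_mul] at key
  have h2 : (∫ U, pairFun m m' (w : ℂ) i * (U : Matrix (Fin N) (Fin N) ℂ) i i * (pairFun m m' (w : ℂ) j * (U : Matrix (Fin N) (Fin N) ℂ) j j)
      * ((starRingEnd ℂ) (pairFun m m' (w : ℂ) k) * (starRingEnd ℂ) ((U : Matrix (Fin N) (Fin N) ℂ) k k))
      * ((starRingEnd ℂ) (pairFun m m' (w : ℂ) l) * (starRingEnd ℂ) ((U : Matrix (Fin N) (Fin N) ℂ) l l)) ∂(haarProbability (Matrix.unitaryGroup (Fin N) ℂ)))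
      = (pairFun m m' (w : ℂ) i * pairFun m m' (w : ℂ) j * (starRingEnd ℂ) (pairFun m m' (w : ℂ) k)
          * (starRingEnd ℂ) (pairFun m m' (w : ℂ) l))
        * ∫ U, (U : Matrix (Fin N) (Fin N) ℂ) i i * (U : Matrix (Fin N) (Fin N) ℂ) j j * (starRingEnd ℂ) ((U : Matrix (Fin N) (Fin N) ℂ) k k) * (starRingEnd ℂ) ((U : Matrix (Fin N) (Fin N) ℂ) l l) ∂(haarProbability (Matrix.unitaryGroup (Fin N) ℂ)) := by
    rw [← integral_const_mul]
    exact integral_congr_ae (ae_of_all _ fun U => by ring)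
  rw [h2] at key
  exact key.symm

/-- Hence: if some diagonal circle rescales the moment by a factor `c ≠ 1`, the moment vanishes. -/
theorem un_integral_diag4_eq_zero_of_factor {i j k l : Fin N} (m m' : Fin N) (w : Circle) (c : ℂ) (hc : c ≠ 1)
    (hval : pairFun m m' (w : ℂ) i * pairFun m m' (w : ℂ) j * (starRingEnd ℂ) (pairFun m m' (w : ℂ) k)
          * (starRingEnd ℂ) (pairFun m m' (w : ℂ) l) = c) :
    ∫ U, (U : Matrix (Fin N) (Fin N) ℂ) i i * (U : Matrix (Fin N) (Fin N) ℂ) j j * (starRingEnd ℂ) ((U : Matrix (Fin N) (Fin N) ℂ) k k) * (starRingEnd ℂ) ((U : Matrix (Fin N) (Fin N) ℂ) l l) ∂(haarProbability (Matrix.unitaryGroup (Fin N) ℂ)) = 0 := by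
  have key := un_integral_diag4_eq_mul i j k l m m' w
  rw [hval] at key
  have h : (1 - c) * ∫ U, (U : Matrix (Fin N) (Fin N) ℂ) i i * (U : Matrix (Fin N) (Fin N) ℂ) j j * (starRingEnd ℂ) ((U : Matrix (Fin N) (Fin N) ℂ) k k) * (starRingEnd ℂ) ((U : Matrix (Fin N) (Fin N) ℂ) l l) ∂(haarProbability (Matrix.unitaryGroup (Fin N) ℂ)) = 0 := by
    linear_combination key
  rcases mul_eq_zero.mp h with h1 | h1
  · exact absurd (sub_eq_zero.mp h1).symm hc
  · exact h1

/-- The powers `w, w², w³, w⁴` of a circle element with `w² = i` are all `≠ 1`, and `w·w̄ = 1`, `w⁻¹ = w̄`. -/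
theorem circle_sq_eq_I_pow_ne_one (w : Circle) (hw : ((w : ℂ)) ^ 2 = I) :
    (w : ℂ) ≠ 1 ∧ (w : ℂ) ^ 2 ≠ 1 ∧ (w : ℂ) ^ 3 ≠ 1 ∧ (w : ℂ) ^ 4 ≠ 1
      ∧ (w : ℂ) * (starRingEnd ℂ) w = 1 ∧ ((w : ℂ))⁻¹ = (starRingEnd ℂ) w := by
  have hI1 : (I : ℂ) ≠ 1 := by
    intro h; have := congrArg Complex.re h; simp at this
  refine ⟨?_, ?_, ?_, ?_, (circle_conj_inv_coe w).2, ?_⟩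
  · intro h; rw [h, one_pow] at hw; exact hI1 hw.symm
  · rw [hw]; exact hI1
  · intro h
    have h6 : ((w : ℂ) ^ 2) ^ 3 = 1 := by rw [← pow_mul, show 2 * 3 = 3 * 2 from rfl, pow_mul, h, one_pow]
    rw [hw, pow_succ, Complex.I_sq] at h6
    have := congrArg Complex.im h6; simp at this
  · rw [show (w : ℂ) ^ 4 = ((w : ℂ) ^ 2) ^ 2 by ring, hw, Complex.I_sq]
    intro h; have := congrArg Complex.re h; norm_num at this
  · rw [← Circle.coe_inv, Circle.coe_inv_eq_conj]

/-- **THE UNPAIRED DEGREE-4 DIAGONAL MOMENTS VANISH**: `∫_{U(N)} U_ii U_jj Ū_kk Ū_ll dU = 0` unless `(k, l) = (i, j)` or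
`(k, l) = (j, i)`. -/
theorem un_integral_diag4_eq_zero {i j k l : Fin N} (h1 : ¬(k = i ∧ l = j)) (h2 : ¬(k = j ∧ l = i)) :
    ∫ U, (U : Matrix (Fin N) (Fin N) ℂ) i i * (U : Matrix (Fin N) (Fin N) ℂ) j j * (starRingEnd ℂ) ((U : Matrix (Fin N) (Fin N) ℂ) k k) * (starRingEnd ℂ) ((U : Matrix (Fin N) (Fin N) ℂ) l l) ∂(haarProbability (Matrix.unitaryGroup (Fin N) ℂ)) = 0 := by
  obtain ⟨w, hw⟩ := exists_circle_sq_eq_I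
  obtain ⟨hw1, hw2, hw3, hw4, hww, hinv⟩ := circle_sq_eq_I_pow_ne_one w hw
  -- each leaf: a circle `pairFun m m' w` and the resulting factor
  by_cases hij : i = j
  · subst hij
    by_cases hki : k = i
    · subst hki
      have hli : l ≠ k := fun h => h1 ⟨rfl, h⟩
      refine un_integral_diag4_eq_zero_of_factor k l w ((w : ℂ) ^ 2) hw2 ?_
      simp only [pairFun_apply_ite, hinv, if_true, if_neg hli, if_neg hli.symm, mul_one, one_mul,
        Complex.conj_conj]
      linear_combination ((w : ℂ) ^ 2) * hww
    · by_cases hli : l = i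
      · subst hli
        refine un_integral_diag4_eq_zero_of_factor l k w ((w : ℂ) ^ 2) hw2 ?_
        simp only [pairFun_apply_ite, hinv, if_true, if_neg hki, if_neg (Ne.symm hki), mul_one, one_mul,
          Complex.conj_conj]
        linear_combination ((w : ℂ) ^ 2) * hww
      · by_cases hlk : l = k
        · subst hlk
          refine un_integral_diag4_eq_zero_of_factor i l w ((w : ℂ) ^ 4) hw4 ?_
          simp only [pairFun_apply_ite, hinv, if_true, if_neg hki, if_neg (Ne.symm hki), mul_one, one_mul,
            Complex.conj_conj]
          ring
        · refine un_integral_diag4_eq_zero_of_factor i k w ((w : ℂ) ^ 3) hw3 ?_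
          simp only [pairFun_apply_ite, hinv, if_true, if_neg hki, if_neg (Ne.symm hki), if_neg hli, if_neg hlk, mul_one,
            one_mul, map_one, Complex.conj_conj]
          ring
  · by_cases hki : k = i
    · subst hki
      have hlj : l ≠ j := fun h => h1 ⟨rfl, h⟩
      by_cases hlk : l = k
      · subst hlk
        refine un_integral_diag4_eq_zero_of_factor j l w ((w : ℂ) ^ 2) hw2 ?_
        simp only [pairFun_apply_ite, hinv, if_true, if_neg hij, if_neg (Ne.symm hij), mul_one, one_mul,
          Complex.conj_conj]
        linear_combination ((w : ℂ) ^ 2) * hww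
      · refine un_integral_diag4_eq_zero_of_factor j l w ((w : ℂ) ^ 2) hw2 ?_
        simp only [pairFun_apply_ite, hinv, if_true, if_neg hij, if_neg (Ne.symm hlk), if_neg hlj, if_neg (Ne.symm hlj),
          mul_one, one_mul, map_one, Complex.conj_conj]
        ring
    · by_cases hkj : k = j
      · subst hkj
        have hli : l ≠ i := fun h => h2 ⟨rfl, h⟩
        by_cases hlk : l = k
        · subst hlk
          refine un_integral_diag4_eq_zero_of_factor i l w ((w : ℂ) ^ 2) hw2 ?_
          simp only [pairFun_apply_ite, hinv, if_true, if_neg hij, if_neg (Ne.symm hij), mul_one, one_mul,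
            Complex.conj_conj]
          linear_combination ((w : ℂ) ^ 2) * hww
        · refine un_integral_diag4_eq_zero_of_factor i l w ((w : ℂ) ^ 2) hw2 ?_
          simp only [pairFun_apply_ite, hinv, if_true, if_neg (Ne.symm hij), if_neg (Ne.symm hlk),
            if_neg hli, if_neg (Ne.symm hli), mul_one, one_mul, map_one, Complex.conj_conj]
          ring
      · -- k ∉ {i, j}
        by_cases hli : l = i
        · subst hli
          refine un_integral_diag4_eq_zero_of_factor l k w (w : ℂ) hw1 ?_
          simp only [pairFun_apply_ite, hinv, if_true, if_neg hki, if_neg (Ne.symm hki), if_neg (Ne.symm hij), if_neg (Ne.symm hkj),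
            mul_one, one_mul, Complex.conj_conj]
          linear_combination (w : ℂ) * hww
        · by_cases hlk : l = k
          · subst hlk
            refine un_integral_diag4_eq_zero_of_factor i l w ((w : ℂ) ^ 3) hw3 ?_
            simp only [pairFun_apply_ite, hinv, if_true, if_neg hki, if_neg (Ne.symm hki), if_neg (Ne.symm hij), if_neg (Ne.symm hkj),
              mul_one, one_mul, Complex.conj_conj]
            ring
          · refine un_integral_diag4_eq_zero_of_factor i k w ((w : ℂ) ^ 2) hw2 ?_
            simp only [pairFun_apply_ite, hinv, if_true, if_neg hki, if_neg (Ne.symm hki), if_neg (Ne.symm hij), if_neg (Ne.symm hkj),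
              if_neg hli, if_neg hlk, mul_one, one_mul, map_one, Complex.conj_conj]
            ring

/-! ## §2 `∫_{U(N)} |tr U|⁴ dU = 2` -/

/-- Expansion `(tr U)²·(conj tr U)² = Σ_i Σ_j Σ_k Σ_l U_ii U_jj Ū_kk Ū_ll`. -/
theorem trace_sq_mul_conj_trace_sq_eq_sum (U : Matrix (Fin N) (Fin N) ℂ) :
    U.trace ^ 2 * ((starRingEnd ℂ) U.trace) ^ 2
      = ∑ i, ∑ j, ∑ k, ∑ l, U i i * U j j * (starRingEnd ℂ) (U k k) * (starRingEnd ℂ) (U l l) := by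
  rw [Matrix.trace, map_sum, sq, sq, Finset.sum_mul_sum, Finset.sum_mul_sum, Finset.sum_mul]
  refine Finset.sum_congr rfl fun i _ => ?_
  rw [Finset.sum_mul]
  refine Finset.sum_congr rfl fun j _ => ?_
  rw [Finset.mul_sum]
  refine Finset.sum_congr rfl fun k _ => ?_
  rw [Finset.mul_sum]
  refine Finset.sum_congr rfl fun l _ => ?_
  simp only [Matrix.diag_apply]
  ring

/-- The paired inner sums: `Σ_k Σ_l ∫ U_ii U_jj Ū_kk Ū_ll` is `∫ |U_ii|⁴` for `i = j` and `2 ∫ |U_ii|²|U_jj|²` for `i ≠ j`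
(as real numbers cast to `ℂ`). -/
theorem un_sum_sum_integral_diag4 (i j : Fin N) :
    ∑ k, ∑ l, ∫ U, (U : Matrix (Fin N) (Fin N) ℂ) i i * (U : Matrix (Fin N) (Fin N) ℂ) j j * (starRingEnd ℂ) ((U : Matrix (Fin N) (Fin N) ℂ) k k) * (starRingEnd ℂ) ((U : Matrix (Fin N) (Fin N) ℂ) l l) ∂(haarProbability (Matrix.unitaryGroup (Fin N) ℂ))
      = if i = j then ((∫ U, Complex.normSq ((U : Matrix (Fin N) (Fin N) ℂ) i i) ^ 2 ∂(haarProbability (Matrix.unitaryGroup (Fin N) ℂ)) : ℝ) : ℂ)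
        else 2 * ((∫ U, Complex.normSq ((U : Matrix (Fin N) (Fin N) ℂ) i i) * Complex.normSq ((U : Matrix (Fin N) (Fin N) ℂ) j j) ∂(haarProbability (Matrix.unitaryGroup (Fin N) ℂ)) : ℝ) : ℂ) := by
  by_cases hij : i = j
  · subst hij
    rw [if_pos rfl]
    have hk0 : ∀ k, k ≠ i → ∑ l, ∫ U, (U : Matrix (Fin N) (Fin N) ℂ) i i * (U : Matrix (Fin N) (Fin N) ℂ) i i * (starRingEnd ℂ) ((U : Matrix (Fin N) (Fin N) ℂ) k k) * (starRingEnd ℂ) ((U : Matrix (Fin N) (Fin N) ℂ) l l) ∂(haarProbability (Matrix.unitaryGroup (Fin N) ℂ)) = 0 :=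
      fun k hk => Finset.sum_eq_zero fun l _ => un_integral_diag4_eq_zero (fun h => hk h.1) (fun h => hk h.1)
    have hl0 : ∀ l, l ≠ i → ∫ U, (U : Matrix (Fin N) (Fin N) ℂ) i i * (U : Matrix (Fin N) (Fin N) ℂ) i i * (starRingEnd ℂ) ((U : Matrix (Fin N) (Fin N) ℂ) i i) * (starRingEnd ℂ) ((U : Matrix (Fin N) (Fin N) ℂ) l l) ∂(haarProbability (Matrix.unitaryGroup (Fin N) ℂ)) = 0 :=
      fun l hl => un_integral_diag4_eq_zero (fun h => hl h.2) (fun h => hl h.2)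
    rw [Finset.sum_eq_single_of_mem i (Finset.mem_univ i) (fun k _ hk => hk0 k hk),
      Finset.sum_eq_single_of_mem i (Finset.mem_univ i) (fun l _ hl => hl0 l hl), ← integral_complex_ofReal]
    refine integral_congr_ae (ae_of_all _ fun U => ?_)
    beta_reduce
    rw [Complex.ofReal_pow, ← Complex.mul_conj]
    ring
  · rw [if_neg hij]
    have hk0 : ∀ k, k ≠ i ∧ k ≠ j → ∑ l, ∫ U, (U : Matrix (Fin N) (Fin N) ℂ) i i * (U : Matrix (Fin N) (Fin N) ℂ) j j * (starRingEnd ℂ) ((U : Matrix (Fin N) (Fin N) ℂ) k k) * (starRingEnd ℂ) ((U : Matrix (Fin N) (Fin N) ℂ) l l) ∂(haarProbability (Matrix.unitaryGroup (Fin N) ℂ)) = 0 :=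
      fun k hk => Finset.sum_eq_zero fun l _ => un_integral_diag4_eq_zero (fun h => hk.1 h.1) (fun h => hk.2 h.1)
    have hli : ∀ l, l ≠ j → ∫ U, (U : Matrix (Fin N) (Fin N) ℂ) i i * (U : Matrix (Fin N) (Fin N) ℂ) j j * (starRingEnd ℂ) ((U : Matrix (Fin N) (Fin N) ℂ) i i) * (starRingEnd ℂ) ((U : Matrix (Fin N) (Fin N) ℂ) l l) ∂(haarProbability (Matrix.unitaryGroup (Fin N) ℂ)) = 0 :=
      fun l hl => un_integral_diag4_eq_zero (fun h => hl h.2) (fun h => hij h.1)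
    have hlj : ∀ l, l ≠ i → ∫ U, (U : Matrix (Fin N) (Fin N) ℂ) i i * (U : Matrix (Fin N) (Fin N) ℂ) j j * (starRingEnd ℂ) ((U : Matrix (Fin N) (Fin N) ℂ) j j) * (starRingEnd ℂ) ((U : Matrix (Fin N) (Fin N) ℂ) l l) ∂(haarProbability (Matrix.unitaryGroup (Fin N) ℂ)) = 0 :=
      fun l hl => un_integral_diag4_eq_zero (fun h => hij h.1.symm) (fun h => hl h.2)
    rw [Fintype.sum_eq_add i j hij hk0, Finset.sum_eq_single_of_mem j (Finset.mem_univ j) (fun l _ hl => hli l hl),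
      Finset.sum_eq_single_of_mem i (Finset.mem_univ i) (fun l _ hl => hlj l hl), ← integral_complex_ofReal, two_mul]
    congr 1
    · refine integral_congr_ae (ae_of_all _ fun U => ?_)
      beta_reduce
      rw [Complex.ofReal_mul, ← Complex.mul_conj, ← Complex.mul_conj]
      ring
    · refine integral_congr_ae (ae_of_all _ fun U => ?_)
      beta_reduce
      rw [Complex.ofReal_mul, ← Complex.mul_conj, ← Complex.mul_conj]
      ring

/-- Bookkeeping: `Σ_i Σ_j (i = j ? a : b) = N·a + N(N−1)·b`. -/
theorem sum_sum_ite_eq_const (a b : ℂ) :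
    ∑ i : Fin N, ∑ j : Fin N, (if i = j then a else b) = (N : ℂ) * a + (N : ℂ) * ((N : ℂ) - 1) * b := by
  have hrow : ∀ i : Fin N, ∑ j : Fin N, (if i = j then a else b) = a + ((N : ℂ) - 1) * b := fun i => by
    rw [← Finset.add_sum_erase _ _ (Finset.mem_univ i), if_pos rfl,
      Finset.sum_congr rfl fun j hj => if_neg (Finset.ne_of_mem_erase hj).symm, Finset.sum_const,
      Finset.card_erase_of_mem (Finset.mem_univ i), Finset.card_univ, Fintype.card_fin, nsmul_eq_mul]
    rcases Nat.eq_zero_or_pos N with h0 | hpos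
    · subst h0; exact (Fin.elim0 i)
    · rw [Nat.cast_sub (by omega : 1 ≤ N), Nat.cast_one]
  simp only [hrow, Finset.sum_const, Finset.card_univ, Fintype.card_fin, nsmul_eq_mul]
  ring

/-- **THE FOURTH TRACE MOMENT OF A HAAR UNITARY: `∫_{U(N)} |tr U|⁴ dU = 2`**, every `N ≥ 2`. -/
theorem un_integral_normSq_trace_sq (hN : 2 ≤ N) :
    ∫ U, Complex.normSq ((U : Matrix (Fin N) (Fin N) ℂ)).trace ^ 2 ∂(haarProbability (Matrix.unitaryGroup (Fin N) ℂ)) = 2 := by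
  have hint : ∀ i j k l : Fin N, Integrable (fun U : Matrix.unitaryGroup (Fin N) ℂ => (U : Matrix (Fin N) (Fin N) ℂ) i i * (U : Matrix (Fin N) (Fin N) ℂ) j j * (starRingEnd ℂ) ((U : Matrix (Fin N) (Fin N) ℂ) k k) * (starRingEnd ℂ) ((U : Matrix (Fin N) (Fin N) ℂ) l l)) (haarProbability (Matrix.unitaryGroup (Fin N) ℂ)) := fun i j k l =>
    integrable_haarUN_of_continuous ((((continuous_UN_entry i i).mul (continuous_UN_entry j j)).mul
      (Complex.continuous_conj.comp (continuous_UN_entry k k))).mul (Complex.continuous_conj.comp (continuous_UN_entry l l)))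
  have hC : ∫ U, ((U : Matrix (Fin N) (Fin N) ℂ)).trace ^ 2 * ((starRingEnd ℂ) ((U : Matrix (Fin N) (Fin N) ℂ)).trace) ^ 2 ∂(haarProbability (Matrix.unitaryGroup (Fin N) ℂ))
      = (N : ℂ) * ((2 / ((N : ℝ) * (N + 1)) : ℝ) : ℂ) + (N : ℂ) * ((N : ℂ) - 1) * (2 * ((1 / ((N : ℝ) ^ 2 - 1) : ℝ) : ℂ)) := by
    simp only [trace_sq_mul_conj_trace_sq_eq_sum]
    rw [integral_finsetSum _ fun i _ => integrable_finsetSum _ fun j _ => integrable_finsetSum _ fun k _ =>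
      integrable_finsetSum _ fun l _ => hint i j k l]
    have h3 : ∀ i : Fin N, ∫ U, ∑ j, ∑ k, ∑ l, (U : Matrix (Fin N) (Fin N) ℂ) i i * (U : Matrix (Fin N) (Fin N) ℂ) j j * (starRingEnd ℂ) ((U : Matrix (Fin N) (Fin N) ℂ) k k) * (starRingEnd ℂ) ((U : Matrix (Fin N) (Fin N) ℂ) l l) ∂(haarProbability (Matrix.unitaryGroup (Fin N) ℂ)) = ∑ j, ∑ k, ∑ l, ∫ U, (U : Matrix (Fin N) (Fin N) ℂ) i i * (U : Matrix (Fin N) (Fin N) ℂ) j j * (starRingEnd ℂ) ((U : Matrix (Fin N) (Fin N) ℂ) k k) * (starRingEnd ℂ) ((U : Matrix (Fin N) (Fin N) ℂ) l l) ∂(haarProbability (Matrix.unitaryGroup (Fin N) ℂ)) := fun i => by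
      rw [integral_finsetSum _ fun j _ => integrable_finsetSum _ fun k _ => integrable_finsetSum _ fun l _ => hint i j k l]
      refine Finset.sum_congr rfl fun j _ => ?_
      rw [integral_finsetSum _ fun k _ => integrable_finsetSum _ fun l _ => hint i j k l]
      refine Finset.sum_congr rfl fun k _ => ?_
      rw [integral_finsetSum _ fun l _ => hint i j k l]
    simp only [h3, un_sum_sum_integral_diag4]
    rw [← sum_sum_ite_eq_const]
    refine Finset.sum_congr rfl fun i _ => Finset.sum_congr rfl fun j _ => ?_
    by_cases hij : i = j
    · subst hij; rw [if_pos rfl, if_pos rfl, un_integral_normSq_sq_entry hN i i]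
    · rw [if_neg hij, if_neg hij, un_integral_normSq_diag_mul_normSq_diag hN hij]
  have hreal : ((N : ℝ) * (2 / ((N : ℝ) * (N + 1))) + (N : ℝ) * ((N : ℝ) - 1) * (2 * (1 / ((N : ℝ) ^ 2 - 1)))) = 2 := by
    have hN1 : (1 : ℝ) < N := by exact_mod_cast (show 1 < N by omega)
    have hA : (N : ℝ) ^ 2 - 1 ≠ 0 := by nlinarith
    have hB : (N : ℝ) + 1 ≠ 0 := by linarith
    have hC0 : (N : ℝ) ≠ 0 := by linarith
    field_simp
    ring
  have h2 : ∫ U, ((Complex.normSq ((U : Matrix (Fin N) (Fin N) ℂ)).trace ^ 2 : ℝ) : ℂ) ∂(haarProbability (Matrix.unitaryGroup (Fin N) ℂ)) = ((2 : ℝ) : ℂ) := by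
    have hval : (N : ℂ) * ((2 / ((N : ℝ) * (N + 1)) : ℝ) : ℂ) + (N : ℂ) * ((N : ℂ) - 1) * (2 * ((1 / ((N : ℝ) ^ 2 - 1) : ℝ) : ℂ))
        = ((2 : ℝ) : ℂ) := by
      have h := congrArg (fun r : ℝ => (r : ℂ)) hreal
      push_cast at h ⊢
      linear_combination h
    rw [← hval, ← hC]
    refine integral_congr_ae (ae_of_all _ fun U => ?_)
    beta_reduce
    rw [Complex.ofReal_pow, ← Complex.mul_conj]
    ring
  rw [integral_complex_ofReal] at h2
  exact_mod_cast h2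

/-- **The Haar variance of `|tr U_p|²` is `1`**: `∫_{U(N)} (|tr U|² − 1)² dU = 1` (`N ≥ 2`; mean `1`, fourth moment `2`). -/
theorem un_integral_normSq_trace_sub_one_sq (hN : 2 ≤ N) :
    ∫ U, (Complex.normSq ((U : Matrix (Fin N) (Fin N) ℂ)).trace - 1) ^ 2 ∂(haarProbability (Matrix.unitaryGroup (Fin N) ℂ)) = 1 := by
  have c_n : Continuous fun U : Matrix.unitaryGroup (Fin N) ℂ => Complex.normSq ((U : Matrix (Fin N) (Fin N) ℂ)).trace :=
    Complex.continuous_normSq.comp (continuous_subtype_val.matrix_trace)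
  have i2 : Integrable (fun U : Matrix.unitaryGroup (Fin N) ℂ => Complex.normSq ((U : Matrix (Fin N) (Fin N) ℂ)).trace ^ 2) (haarProbability (Matrix.unitaryGroup (Fin N) ℂ)) :=
    integrable_haarUN_of_continuous_real (c_n.pow 2)
  have i1 : Integrable (fun U : Matrix.unitaryGroup (Fin N) ℂ => 2 * Complex.normSq ((U : Matrix (Fin N) (Fin N) ℂ)).trace) (haarProbability (Matrix.unitaryGroup (Fin N) ℂ)) :=
    integrable_haarUN_of_continuous_real (continuous_const.mul c_n)
  have hexp : ∀ U : Matrix.unitaryGroup (Fin N) ℂ, (Complex.normSq ((U : Matrix (Fin N) (Fin N) ℂ)).trace - 1) ^ 2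
      = Complex.normSq ((U : Matrix (Fin N) (Fin N) ℂ)).trace ^ 2 - 2 * Complex.normSq ((U : Matrix (Fin N) (Fin N) ℂ)).trace + 1 := fun U => by ring
  simp_rw [hexp]
  rw [integral_add (i2.sub' i1) (integrable_const 1), integral_sub i2 i1, integral_const_mul,
    un_integral_normSq_trace_sq hN, un_integral_normSq_trace (by omega), integral_const, smul_eq_mul, probReal_univ]
  ring

end Summit.Ventures.LatticeQCDFlow.Scoring
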